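import Summits.CriticalPhenomena.PercolationContinuityZ3.Theorems.Transplant.FKConnectivityAllQApexHubOne
import Summits.CriticalPhenomena.PercolationContinuityZ3.Theorems.Transplant.FKConnectivityAllQApexHubTwo
import Summits.CriticalPhenomena.PercolationContinuityZ3.Theorems.Transplant.FKConnectivityAllQApexHubThree
import Summits.CriticalPhenomena.PercolationContinuityZ3.Theorems.Transplant.FKConnectivityAllQArborealLimit
import HarnessLib

/-!
# Connectivity correlation inequalities for `φ_{w,q}`, every `q > 0` — the HUB INEQUALITY AT AN APEX, file 6:
# EVERY TRIPLE OF EVERY WEIGHTED DOUBLE CONE (`K_{2,m}`, `K_{1,1,m}`, loops at the hubs allowed), `0 < q ≤ 1`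

Support file (`--supports stmt-CriticalPhenomena-4575`), census seat `prim-bschramm-census` (gen 22) of the post-continuity
programme; builds on p205010 (kernel theorem, internal audit signed; external expert review pending).  No definitions, no named
facts, no sorries; standard axioms.

**`hubUnder_doubleCone`**: if every live pair of `w` contains `u` or `v` (`u ≠ v`) — i.e. the support of `w` is a sub-multigraph of the
double cone with hubs `u, v` over all other vertices, the hub pair `uv` and loops at the hubs allowed — then for EVERY `0 < q ≤ 1` and
ALL vertices `o, a, b`, `φ_{w,q}(o ↔ a)·φ_{w,q}(b ↔ a) ≤ φ_{w,q}(o ↔ a ↔ b)` (`FK.HubUnder`; Ayyer–Linusson–Ravichandran's (13) in the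
strong form (14)).  For `q ≥ 1` this is FKG (`hubFK_of_one_le`); for `q < 1` it is assembled from the five apex theorems of files 2, 4, 5g
(`hubUnder_apex_series/hub/hub'`, `hubUnder_apex_two_hub/two_leaf`, `hubUnder_apex_three`) by a case analysis on which of `o, a, b` are
hubs, plus the degenerate triples.  These double cones are exactly the family on which CLUSTER ASSOCIATION fails (`FK.not_clusterAssocFKPos`,
`K_{2,34}`, census gen 21): the mechanism that kills CA does not touch the hub inequality.  Not in print as far as searched (ALR prove the
outerplanar arboreal-gas case, Cor. 5.4; `K_{2,3}` is the excluded minor of outerplanarity; the tree's series–parallel theorems need the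
two hub pairs to be edges of the support).  **`hubUnder_agMeasure_doubleCone`**: the same for the ARBOREAL GAS with
parameters `w` (Ayyer–Linusson–Ravichandran's Conjecture 7.1, eq. (15), at every triple of every weighted double cone), by the tree's
`q ↓ 0` transfer `hubUnder_agMeasure_of_forall` (fk-1 g9).
[cite: AyyerLinussonRavichandran2025, §7 eq. (13)–(15), Conj. 7.1, Cor. 5.4 (p. 22)] [cite: Grimmett2006, §3.9 (p. 63); Thm. (3.8)]
-/

noncomputable section

namespace Summit.CriticalPhenomena.PercolationContinuityZ3.Theorems

namespace FK

open MeasureTheory Set Literature.Probability.LatticeModels Literature.Probability.Percolation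
open scoped Classical

variable {V : Type*} [Fintype V]

omit [Fintype V] in
/-- The hub inequality is symmetric in its two legs. [folklore] -/
theorem hubUnder_symm {μ : Measure (BondConfig V)} {o a b : V} (h : HubUnder μ o a b) : HubUnder μ b a o := by
  unfold HubUnder at h ⊢
  rw [mul_comm, Set.inter_comm]
  exact h

omit [Fintype V] in
/-- The degenerate triple `o = a`: `{a ↔ a}` is everything. [folklore] -/
theorem hubUnder_left_eq (μ : Measure (BondConfig V)) [IsFiniteMeasure μ] (a b : V) : HubUnder μ a a b := by
  unfold HubUnder
  have h : (openConn a a : Set (BondConfig V)) = Set.univ :=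
    Set.eq_univ_of_forall fun ω => (mem_openConn_iff' a a ω).2 SimpleGraph.Reachable.rfl
  rw [h, Set.univ_inter]

omit [Fintype V] in
/-- The degenerate triple `o = b`: `μ(A)² ≤ μ(Ω)μ(A)`. [folklore] -/
theorem hubUnder_legs_eq (μ : Measure (BondConfig V)) [IsFiniteMeasure μ] (o a : V) : HubUnder μ o a o := by
  unfold HubUnder
  rw [Set.inter_self]
  exact mul_le_mul_of_nonneg_right (measureReal_mono (Set.subset_univ _)) measureReal_nonneg

/-- **ALR's hub inequality at every triple of every weighted double cone**, `0 < q ≤ 1`: if every live pair of `w` contains one of the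
two hubs `u ≠ v`, then `φ_{w,q}(o ↔ a)·φ_{w,q}(b ↔ a) ≤ φ_{w,q}(o ↔ a ↔ b)` for all `o, a, b`.
[cite: AyyerLinussonRavichandran2025, §7 eq. (13)–(15), Conj. 7.1 (p. 22)] [cite: Grimmett2006, §3.9 (p. 63)] -/
theorem hubUnder_doubleCone (w : Sym2 V → unitInterval) {q : ℝ} (hq : 0 < q) (hq1 : q ≤ 1) {u v : V} (huv : u ≠ v)
    (hw : ∀ e : Sym2 V, ((w e : unitInterval) : ℝ) ≠ 0 → u ∈ e ∨ v ∈ e) (o a b : V) :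
    HubUnder (rcMeasureW w q ∅) o a b := by
  haveI := isProbabilityMeasure_rcMeasureW w hq (∅ : Set V)
  -- every vertex off the hubs is an apex, over `(u, v)` and over `(v, u)`
  have hap : ∀ x : V, ∀ e : Sym2 V, x ∈ e → ((w e : unitInterval) : ℝ) ≠ 0 → u ∈ e ∨ v ∈ e := fun x e _ he => hw e he
  have hap' : ∀ x : V, ∀ e : Sym2 V, x ∈ e → ((w e : unitInterval) : ℝ) ≠ 0 → v ∈ e ∨ u ∈ e :=
    fun x e hx he => (hw e he).symm
  -- degenerate triples
  by_cases hoa : o = a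
  · subst hoa; exact hubUnder_left_eq _ o b
  by_cases hba : b = a
  · subst hba; exact hubUnder_symm (hubUnder_left_eq _ b o)
  by_cases hob : o = b
  · subst hob; exact hubUnder_legs_eq _ o a
  -- the hub of the inequality is `u`
  by_cases hau : a = u
  · subst hau
    by_cases hov : o = v
    · subst hov
      have hbu : b ≠ a := hba
      have hbv : b ≠ o := fun h => hob h.symm
      exact hubUnder_apex_hub w hq hbu hbv huv (hap b)
    · by_cases hbv : b = v
      · subst hbv
        exact hubUnder_apex_hub' w hq hoa hov huv (hap o)
      · exact hubUnder_apex_two_hub w hq hq1 hoa hov hba hbv hob huv (hap o) (hap b)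
  -- the hub of the inequality is `v`
  by_cases hav : a = v
  · subst hav
    by_cases hou : o = u
    · subst hou
      have hbv : b ≠ a := hba
      have hbu : b ≠ o := fun h => hob h.symm
      exact hubUnder_apex_hub (u := a) (v := o) w hq hbv hbu huv.symm (hap' b)
    · by_cases hbu : b = u
      · subst hbu
        exact hubUnder_apex_hub' (u := a) (v := b) w hq hoa hou huv.symm (hap' o)
      · exact hubUnder_apex_two_hub (u := a) (v := u) w hq hq1 hoa hou hba hbu hob huv.symm (hap' o) (hap' b)
  -- the hub of the inequality is an apex
  by_cases hou : o = u
  · subst hou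
    by_cases hbv : b = v
    · subst hbv
      exact hubUnder_apex_series w hq hau hav huv (hap a)
    · have hbu : b ≠ o := fun h => hob h.symm
      exact hubUnder_apex_two_leaf w hq hq1 hau hav hbu hbv (fun h => hba h.symm) huv (hap a) (hap b)
  by_cases hov : o = v
  · subst hov
    by_cases hbu : b = u
    · subst hbu
      exact hubUnder_symm (hubUnder_apex_series w hq hau hav huv (hap a))
    · have hbv : b ≠ o := fun h => hob h.symm
      exact hubUnder_apex_two_leaf (u := o) (v := u) w hq hq1 hav hau hbv hbu (fun h => hba h.symm) huv.symm (hap' a) (hap' b)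
  -- `o` is an apex
  by_cases hbu : b = u
  · subst hbu
    exact hubUnder_symm (hubUnder_apex_two_leaf w hq hq1 hau hav hou hov (fun h => hoa h.symm) huv (hap a) (hap o))
  by_cases hbv : b = v
  · subst hbv
    exact hubUnder_symm
      (hubUnder_apex_two_leaf (u := b) (v := u) w hq hq1 hav hau hov hou (fun h => hoa h.symm) huv.symm (hap' a) (hap' o))
  -- all three are apexes
  exact hubUnder_apex_three w hq hq1 hau hav hou hov hbu hbv (fun h => hoa h.symm) (fun h => hba h.symm) hob huv
    (hap a) (hap o) (hap b)

/-- **ALR Conjecture 7.1 (15) at every triple of every weighted double cone** — the arboreal gas with parameters `w` supported on a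
double cone with hubs `u ≠ v` satisfies `μ(o ↔ a)μ(b ↔ a) ≤ μ(Ω)μ(o ↔ a ↔ b)` for all `o, a, b` (the `q ↓ 0` limit of `hubUnder_doubleCone`
along the arboreal curve). [cite: AyyerLinussonRavichandran2025, §7 eq. (15), Conj. 7.1, Cor. 5.4 (p. 22)] [cite: Grimmett2006, §1.5 Thm. (1.23) (pp. 13–14)] -/
theorem hubUnder_agMeasure_doubleCone (w : Sym2 V → unitInterval) {u v : V} (huv : u ≠ v)
    (hw : ∀ e : Sym2 V, ((w e : unitInterval) : ℝ) ≠ 0 → u ∈ e ∨ v ∈ e) (o a b : V) : HubUnder (agMeasure w) o a b :=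
  hubUnder_agMeasure_of_forall w o a b fun q hq0 hq1 =>
    hubUnder_doubleCone (agParams w q) hq0 hq1.le huv (agParams_supp w hq0 (S := {e : Sym2 V | u ∈ e ∨ v ∈ e}) hw) o a b

end FK

end Summit.CriticalPhenomena.PercolationContinuityZ3.Theorems

end
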